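import Summits.CriticalPhenomena.PercolationContinuityZ3.Theorems.PercNearOneGluingNoHeavyLowerTailKNConj4OfCSH
import HarnessLib

/-! # Crux `PercNearOneGluing.AdditiveGluing` (stmt-CriticalPhenomena-4576) — the weakest-port gluing lemma (LEMMA Q of the
# V⁺-form lane, memo MEMO-gen7 §2 of run/shared/lean/prim/prim-png-dp-vplus/) for EVERY block size, from Kozma–Nitzan's Conjecture 2

Support file (`--supports stmt-CriticalPhenomena-4576`, seat (b) V⁺-form `png-dp-vplus`, gen 10); no definitions, no named facts, no sorries.

For bond percolation `μ = prodBernoulli w` on the weighted complete graph `Fin n`, a target `b`, a vertex set `B` and a vertex `x`, gluing `B`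
into one vertex raises the two-point function of `x` from `μ(x ↔ b)` by the GAIN `μ(x ↮ b, x ↔ B, B ↔ b)`.  The *weakest-port gluing lemma*
(LEMMA Q of MEMO-gen7, the case "every member of `B` is a port"; gen 7 landed `|B| = 2` as `pairGlue_real_ge` and the slack regime as
`setGlue_real_le_add_posPart`, `…AdditiveGluingPairGluing.lean`; `|B| ≥ 3` was open, with a Farkas obstruction to transport proofs) says

  `μ(x ↮ b, x ↔ B, B ↔ b) + min_{u ∈ B} μ(u ↔ b) ≤ μ(B ↔ b)`   for EVERY vertex `x` and every nonempty `B`.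

THIS FILE proves it for every `|B|`, as a two-line corollary of Kozma–Nitzan's Conjecture 2 / display (3) — now the tree theorem
`PreFKGSurplus.kn_conj2_holds` (prim-ineq-gen-6 over prim-hp-8's conditioned slack hierarchy): with observer `x` and relay set `B`, (3) gives some
`a ∈ B` with `μ(a ↔ b, x ↔ B) ≤ μ(x ↔ b, x ↔ B)`; then `μ(a↔b) = μ(a↔b, x↔B) + μ(a↔b, x↮B) ≤ μ(x↔b, x↔B) + μ(B↔b, x↮B)`, and the two events on
the right together with the gain event `{x↮b, x↔B, B↔b}` are pairwise disjoint subsets of `{B ↔ b}`.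
* `weakestPortGluing_exists` — non-degenerate weights, `∃ a ∈ B` form (exactly what (3) delivers);
* `weakestPortGluing_inf` — ALL weights in `[0,1]`, min-form (closure principle `weights_le_of_forall_pos_lt_one`, both sides continuous);
* `weakestPortGluing` — all weights, designated form: for every `u ∈ B` of least two-point function.
[cite: KozmaNitzan2024, Conj. 2 / display (3) (p. 3), Lemma 5 (p. 13), §3.1 (gluing)]
-/

noncomputable section

namespace Summit.CriticalPhenomena.PercolationContinuityZ3.Theorems

open MeasureTheory Set Literature.Probability.LatticeModels Literature.Probability.Percolation
open scoped Classical

variable {n : ℕ}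

/-- **Weakest-port gluing, `∃`-form, non-degenerate weights.**  For every nonempty `B`, every `x` and `b`:
some `a ∈ B` has `μ(x ↮ b, x ↔ B, B ↔ b) + μ(a ↔ b) ≤ μ(B ↔ b)`.  (Kozma–Nitzan (3) at observer `x`, relays `B`, plus set algebra.)
[cite: KozmaNitzan2024, Conj. 2 / display (3) (p. 3)] -/
theorem weakestPortGluing_exists (w : Sym2 (Fin n) → unitInterval) (hw : ∀ e, 0 < w e ∧ w e < 1)
    (B : Finset (Fin n)) (x b : Fin n) (hB : B.Nonempty) :
    ∃ a ∈ B, (prodBernoulli w).real ((openConn x b)ᶜ ∩ ((⋃ y ∈ B, openConn x y) ∩ ⋃ y ∈ B, openConn y b)) +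
        (prodBernoulli w).real (openConn a b) ≤ (prodBernoulli w).real (⋃ y ∈ B, openConn y b) := by
  obtain ⟨a, haB, h3⟩ := PreFKGSurplus.kn_conj2_holds w hw B x b hB
  refine ⟨a, haB, ?_⟩
  set μ := prodBernoulli w with hμ
  set XB : Set (BondConfig (Fin n)) := ⋃ y ∈ B, openConn x y with hXB
  set Bb : Set (BondConfig (Fin n)) := ⋃ y ∈ B, openConn y b with hBb
  set Xb : Set (BondConfig (Fin n)) := openConn x b with hXb
  set Ab : Set (BondConfig (Fin n)) := openConn a b with hAb
  have hmeas : ∀ S : Set (BondConfig (Fin n)), MeasurableSet S := fun _ => MeasurableSet.of_discrete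
  -- membership unfolding for the two unions
  have memXB : ∀ ω : BondConfig (Fin n), ω ∈ XB ↔ ∃ y ∈ B, (openGraph ω).Reachable x y := by
    intro ω; simp only [hXB, mem_iUnion, exists_prop]; rfl
  have memBb : ∀ ω : BondConfig (Fin n), ω ∈ Bb ↔ ∃ y ∈ B, (openGraph ω).Reachable y b := by
    intro ω; simp only [hBb, mem_iUnion, exists_prop]; rfl
  -- `μ(a↔b) = μ(a↔b ∩ x↔B) + μ(a↔b \ x↔B)`
  have h1 : μ.real Ab = μ.real (Ab ∩ XB) + μ.real (Ab \ XB) :=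
    (measureReal_inter_add_sdiff (hmeas XB) (measure_ne_top _ _)).symm
  -- the three pieces `x↔b ∩ x↔B`, `a↔b \ x↔B`, gain are pairwise disjoint subsets of `B↔b`
  have hsub1 : Xb ∩ XB ⊆ Bb := by
    rintro ω ⟨hxb, hxB⟩
    obtain ⟨y, hy, hxy⟩ := (memXB ω).1 hxB
    exact (memBb ω).2 ⟨y, hy, (hxy.symm.trans hxb :)⟩
  have hsub2 : Ab \ XB ⊆ Bb \ XB := by
    rintro ω ⟨hab, hxB⟩
    exact ⟨(memBb ω).2 ⟨a, haB, hab⟩, hxB⟩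
  have hsub3 : Xbᶜ ∩ (XB ∩ Bb) ⊆ (Bb ∩ XB) \ Xb := by
    rintro ω ⟨hxb, hxB, hBb'⟩
    exact ⟨⟨hBb', hxB⟩, hxb⟩
  -- `μ(B↔b) ≥ μ(x↔b ∩ x↔B) + μ(gain) + μ(B↔b \ x↔B)`
  have hd12 : Disjoint (Xb ∩ XB) ((Bb ∩ XB) \ Xb) := by
    rw [Set.disjoint_left]
    rintro ω ⟨hxb, -⟩ ⟨-, hxb'⟩
    exact hxb' hxb
  have hU12 : (Xb ∩ XB) ∪ ((Bb ∩ XB) \ Xb) ⊆ Bb ∩ XB := by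
    apply Set.union_subset
    · intro ω hω; exact ⟨hsub1 hω, hω.2⟩
    · exact fun ω hω => hω.1
  have h2 : μ.real (Xb ∩ XB) + μ.real ((Bb ∩ XB) \ Xb) ≤ μ.real (Bb ∩ XB) := by
    rw [← measureReal_union hd12 (hmeas _)]
    exact measureReal_mono hU12 (measure_ne_top _ _)
  have h3' : μ.real (Bb ∩ XB) + μ.real (Bb \ XB) = μ.real Bb := measureReal_inter_add_sdiff (hmeas XB) (measure_ne_top _ _)
  have h4 : μ.real (Ab \ XB) ≤ μ.real (Bb \ XB) := measureReal_mono hsub2 (measure_ne_top _ _)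
  have h5 : μ.real (Xbᶜ ∩ (XB ∩ Bb)) ≤ μ.real ((Bb ∩ XB) \ Xb) := measureReal_mono hsub3 (measure_ne_top _ _)
  -- (3): `μ(a↔b ∩ x↔B) ≤ μ(x↔b ∩ x↔B)`
  have h6 : μ.real (Ab ∩ XB) ≤ μ.real (Xb ∩ XB) := h3
  linarith [h1, h2, h3', h4, h5, h6]

/-- **Weakest-port gluing lemma, min-form, ALL weights.**  For every nonempty `B`, every `x` and `b`:
`μ(x ↮ b, x ↔ B, B ↔ b) + min_{u ∈ B} μ(u ↔ b) ≤ μ(B ↔ b)` — the gain of any vertex from gluing `B` is at most the amount by which `B` beats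
its weakest member.  (From `weakestPortGluing_exists` by the closure principle over degenerate weights: both sides are continuous in the weights.)
[cite: KozmaNitzan2024, Conj. 2 / display (3) (p. 3), §3.1 (gluing)] -/
theorem weakestPortGluing_inf (w : Sym2 (Fin n) → unitInterval) (B : Finset (Fin n)) (x b : Fin n) (hB : B.Nonempty) :
    (prodBernoulli w).real ((openConn x b)ᶜ ∩ ((⋃ y ∈ B, openConn x y) ∩ ⋃ y ∈ B, openConn y b)) +
        B.inf' hB (fun u => (prodBernoulli w).real (openConn u b)) ≤ (prodBernoulli w).real (⋃ y ∈ B, openConn y b) := by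
  refine weights_le_of_forall_pos_lt_one
    (f := fun p : Sym2 (Fin n) → unitInterval =>
      (prodBernoulli p).real ((openConn x b)ᶜ ∩ ((⋃ y ∈ B, openConn x y) ∩ ⋃ y ∈ B, openConn y b)) +
        B.inf' hB (fun u => (prodBernoulli p).real (openConn u b)))
    (g := fun p : Sym2 (Fin n) → unitInterval => (prodBernoulli p).real (⋃ y ∈ B, openConn y b)) ?_ ?_ ?_ w
  · refine (prodBernoulli_real_continuous _).add ?_
    exact Continuous.finset_inf'_apply hB fun u _ => prodBernoulli_real_continuous _
  · exact prodBernoulli_real_continuous _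
  · intro p hp
    obtain ⟨a, haB, h⟩ := weakestPortGluing_exists p hp B x b hB
    have hinf : B.inf' hB (fun u => (prodBernoulli p).real (openConn u b)) ≤ (prodBernoulli p).real (openConn a b) :=
      Finset.inf'_le _ haB
    show _ + _ ≤ _
    linarith

/-- **Weakest-port gluing lemma (LEMMA Q, all ports), designated form, all weights.**  If `u ∈ B` has the least two-point function on `B`
then for every vertex `x`:  `μ(x ↮ b, x ↔ B, B ↔ b) + μ(u ↔ b) ≤ μ(B ↔ b)`, i.e. `μ_{/B}(x ↔ b) − μ(B ↔ b) ≤ μ(x ↔ b) − μ(u ↔ b)`.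
For `B = {u, v}` this is `pairGlue_real_ge`. [cite: KozmaNitzan2024, Conj. 2 / display (3) (p. 3), Lemma 5 (p. 13)] -/
theorem weakestPortGluing (w : Sym2 (Fin n) → unitInterval) (B : Finset (Fin n)) (x b u : Fin n) (hu : u ∈ B)
    (hmin : ∀ v ∈ B, (prodBernoulli w).real (openConn u b) ≤ (prodBernoulli w).real (openConn v b)) :
    (prodBernoulli w).real ((openConn x b)ᶜ ∩ ((⋃ y ∈ B, openConn x y) ∩ ⋃ y ∈ B, openConn y b)) +
        (prodBernoulli w).real (openConn u b) ≤ (prodBernoulli w).real (⋃ y ∈ B, openConn y b) := by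
  have hB : B.Nonempty := ⟨u, hu⟩
  have h := weakestPortGluing_inf w B x b hB
  have hinf : B.inf' hB (fun v => (prodBernoulli w).real (openConn v b)) = (prodBernoulli w).real (openConn u b) := by
    apply le_antisymm (Finset.inf'_le _ hu)
    exact Finset.le_inf' hB _ fun v hv => hmin v hv
  rw [hinf] at h
  exact h

end Summit.CriticalPhenomena.PercolationContinuityZ3.Theorems

end
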